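import Literature.AnabelianGeometry.EtaleTheta.ThetaCohomologyAnchored
import Literature.AnabelianGeometry.EtaleTheta.ContH1ActionCongr
import HarnessLib

/-!
# [EtTh] Prop. 1.4 (iii) / Def. 1.9: `K̈`-rational points of `Ÿ` FROM GALOIS SECTIONS — a generic
# constructor of `NonCuspidalPoint` / `AnchoredPoint` / `StandardData` (non-vacuity of the value layer)

S. Mochizuki, *The étale theta function and its Frobenioid-theoretic manifestations*, Publ. RIMS **45**
(2009), §1: Prop. 1.4 (iii) p. 22 ("if `L` is a finite extension of `K` and `y ∈ Ÿ(L)` is a non-cuspidal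
point, then the restricted classes … `∈ H¹(G_L, Δ_Θ) ≅ H¹(G_L, Ẑ(1)) ≅ (L^×)^∧` … lie in `L^× ⊆ (L^×)^∧`
and are equal to the values …"), Def. 1.9 p. 29 (the points `τ`, `τ⁻¹`) (printed 248, 255)
[cite: MochizukiEtTh2009, Prop 1.4 (iii) p.22]. Layer L2 of the abc-iut cell, seat abc-iut-L2-t6 (gen 5):
part of file F7 of abc-iut-L2-lead (gen 3) RULINGS #13 R100 (R78 cluster, hand #4 = the E-indexed VALUE
layer). GENERIC over the frozen interface (`ThetaSetting`, `KummerData`, `NonCuspidalPoint`,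
`AnchoredPoint`, `MuTwoSetting.StandardData`, `AnchoredStandardData`): class (b) CONSTRUCTIONS of frozen
records, no interface clause touched, no `Prop` fact.

THE MECHANISM. A `K̈`-rational point `y` of `Ÿ` gives a decomposition group `D_y ≤ Π^tp_Ÿ` mapping
isomorphically onto `G_K̈`, i.e. a continuous SECTION `s : G_K̈ → Π^tp_Ÿ` of the augmentation with
`D_y = s(G_K̈)`; and "`H¹(D_y, Δ_Θ) ≅ H¹(G_K̈, Ẑ(1)) ≅ (K̈^×)^∧`" (p. 22) is the pull-back along `s`. So,
given
* a continuous homomorphism `s : G_{ℚ_p} → Π^tp_X` with `aug ∘ s = id` ON `G_K̈` and `s(G_K̈) ≤ Π^tp_Ÿ`,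
* a PRESENTATION `eK : (K̈^×)^∧ ≃* H¹(G_K̈, Δ_Θ)` of the Kummer datum's `KddHat` as the tree's
  `ContH1 (toTheta ∘ s) Δ_Θ G_K̈`, compatible with `kumYdd` (`heK`: pulling `infl κ(c)` back along `s` gives
  `eK c` — for a model whose `KddHat` IS that `ContH1` and whose `kumYdd` is the pull-back along the
  augmentation this is the section retraction `ContH1.comap_section_comap'`),
the record `NonCuspidalPoint E` is inhabited with `D_y := s(G_K̈)`, `evalAt := eK⁻¹ ∘ (pull-back along s)`
(`evalAt_kum` = `heK`; `evalAt` injective by `ContH1.comap_injective_of_section`), and ANY coordinate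
`u ∈ K̈^×` off the cusps `±q̈^ℤ` (`KummerData.nonCuspidalPointOfSection`); it is ANCHORED
(`AnchoredPoint`, abc-iut-L2-t1's repair of F-0590: `log(Ü)|_y` evaluates to `Ü(y)`) iff moreover
`log(Ü)` pulled back along `s` presents `κ(u)` (`hanch`; `KummerData.anchoredPointOfSection`). Two such
anchored sections with coordinates `√−1`, `(√−1)⁻¹` and `√−1 ∈ K` give `StandardData` /
`AnchoredStandardData` (Def. 1.9; `MuTwoSetting.standardDataOfSections`, `anchoredStandardDataOfSections`).
WHY THE PRESENTATION IS NEEDED (design note F-t6g5-1 of this seat): `evalAt` is a RETRACTION of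
`H¹(D_y, Δ_Θ)` onto `KddHat` along the Kummer map, so at a model with non-trivial cyclotomic action a
`KddHat := K̈^×` admits no such point (`Hom(Ẑ, ℤ) = 0`), whereas `KddHat := H¹(G_K̈, Δ_Θ)` does.
HONEST FRAMING: non-vacuity constructors; at a semi-synthetic model the sections need not come from
points of a curve and the values of `η̈^Θ` at them are NOT the printed `Θ̈(Ü(y))` (those laws remain
binders); typed ≠ proved; no side is taken on [IUTchIII] Cor. 3.12.
-/

noncomputable section

namespace Literature.AnabelianGeometry.EtaleTheta

open Literature.AnabelianGeometry.SemiGraphs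

namespace ThetaSetting

variable {p : ℕ} [Fact p.Prime] {D : ThetaSetting p}

/-! ### The section subgroup `D_y := s(G_K̈)` -/

section SectionSubgroup

variable (s : GQp p →* D.PiTemp) (hsec : ∀ g : GQp p, g ∈ D.GKdd → D.aug (s g) = g)

include hsec

/-- `aug` is injective on `s(G_K̈)` when `aug ∘ s = id` on `G_K̈`. [cite: MochizukiEtTh2009, Prop 1.4 (iii) p.22] -/
theorem aug_injOn_map_section : Set.InjOn D.aug (D.GKdd.map s : Set D.PiTemp) := by
  rintro _ ⟨g, hg, rfl⟩ _ ⟨g', hg', rfl⟩ h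
  have h1 : D.aug (s g) = D.aug (s g') := h
  rw [hsec g hg, hsec g' hg'] at h1
  rw [h1]

/-- `aug(s(G_K̈)) = G_K̈`. [cite: MochizukiEtTh2009, Prop 1.4 (iii) p.22] -/
theorem map_aug_map_section : (D.GKdd.map s).map D.aug.toMonoidHom = D.GKdd := by
  ext g
  constructor
  · rintro ⟨_, ⟨g', hg', rfl⟩, rfl⟩
    change D.aug (s g') ∈ D.GKdd
    rwa [hsec g' hg']
  · intro hg
    exact ⟨s g, ⟨g, hg, rfl⟩, hsec g hg⟩

/-- `s ∘ aug = id` ON `s(G_K̈)` (the form the local section retraction uses). [cite: MochizukiEtTh2009, Prop 1.4 (iii) p.22] -/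
theorem section_aug_of_mem (x : D.PiTemp) (hx : x ∈ D.GKdd.map s) : s (D.aug.toMonoidHom x) = x := by
  obtain ⟨g, hg, rfl⟩ := hx
  change s (D.aug (s g)) = s g
  rw [hsec g hg]

/-- `aug` maps `s(G_K̈)` into `G_K̈`. [cite: MochizukiEtTh2009, Prop 1.4 (iii) p.22] -/
theorem map_aug_map_section_le : (D.GKdd.map s).map D.aug.toMonoidHom ≤ D.GKdd :=
  (map_aug_map_section s hsec).le

end SectionSubgroup

/-! ### Evaluation at a section-point -/

namespace KummerData

variable (E : D.KummerData) (s : GQp p →* D.PiTemp) (hs : Continuous s)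
  (hsec : ∀ g : GQp p, g ∈ D.GKdd → D.aug (s g) = g) (hsY : D.GKdd.map s ≤ D.GtpYdd)
  (eK : E.KddHat ≃* ContH1 (D.toTheta.comp s) D.DeltaTheta D.GKdd)

/-- **The evaluation map at the section-point `D_y = s(G_K̈)`**: `H¹(D_y, Δ_Θ) → H¹(G_K̈, Δ_Θ) ≅ (K̈^×)^∧`,
the pull-back along `s` followed by the inverse of the presentation `eK` ("the restricted classes …
`∈ H¹(G_L, Δ_Θ) ≅ H¹(G_L, Ẑ(1)) ≅ (L^×)^∧`", p. 22). [cite: MochizukiEtTh2009, Prop 1.4 (iii) p.22] -/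
def evalAtOfSection : D.H1 (D.GKdd.map s) →* E.KddHat :=
  eK.symm.toMonoidHom.comp (ContH1.comap D.toTheta D.DeltaTheta s hs le_rfl)

/-- `evalAtOfSection` unfolded. [cite: MochizukiEtTh2009, Prop 1.4 (iii) p.22] -/
theorem evalAtOfSection_apply (x : D.H1 (D.GKdd.map s)) :
    E.evalAtOfSection s hs eK x = eK.symm (ContH1.comap D.toTheta D.DeltaTheta s hs le_rfl x) := rfl

/-- Restricting from `Π^tp_Ÿ` to `s(G_K̈)` and pulling back along `s` is pulling back along `s` directly.
[cite: MochizukiEtTh2009, Prop 1.4 (iii) p.22] -/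
theorem comap_section_res (x : D.H1 D.GtpYdd) :
    ContH1.comap D.toTheta D.DeltaTheta s hs le_rfl (ContH1.res D.toTheta D.DeltaTheta hsY x) =
      ContH1.comap D.toTheta D.DeltaTheta s hs hsY x := by
  induction x using QuotientGroup.induction_on with
  | H f => rfl

include hsec in
/-- **`evalAt` at a section-point is injective** (`H¹(D_y, Δ_Θ) ≅ H¹(G_K̈, Δ_Θ)`: `s` and `aug` are
mutually inverse between `G_K̈` and `D_y`). [cite: MochizukiEtTh2009, Prop 1.4 (iii) p.22] -/
theorem evalAtOfSection_injective : Function.Injective (E.evalAtOfSection s hs eK) := by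
  intro x y hxy
  have h : ContH1.comap D.toTheta D.DeltaTheta s hs le_rfl x =
      ContH1.comap D.toTheta D.DeltaTheta s hs le_rfl y :=
    eK.symm.injective hxy
  exact ContH1.comap_injective_of_section D.toTheta D.DeltaTheta s hs D.aug.toMonoidHom D.aug.continuous
    (H₀ := D.GKdd.map s) (fun x hx => section_aug_of_mem s hsec x hx)
    (map_aug_map_section_le s hsec) le_rfl h

/-- **The Kummer retraction at a section-point**: if pulling `infl κ(c)` back along `s` presents `c`
(`heK`), then `evalAt (κ(c)|_{D_y}) = c` — the field `NonCuspidalPoint.evalAt_kum`.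
[cite: MochizukiEtTh2009, Prop 1.4 (iii) p.22] -/
theorem evalAtOfSection_kum
    (heK : ∀ c : E.KddHat, ContH1.comap D.toTheta D.DeltaTheta s hs hsY
      (D.inflTheta D.GtpYdd (E.kumYdd c)) = eK c) (c : E.KddHat) :
    E.evalAtOfSection s hs eK (ContH1.res D.toTheta D.DeltaTheta hsY
      (D.inflTheta D.GtpYdd (E.kumYdd c))) = c := by
  rw [evalAtOfSection_apply, comap_section_res, heK, MulEquiv.symm_apply_apply]

include hsec in
/-- **A non-cuspidal `K̈`-point of `Ÿ` from a Galois section** (non-vacuity constructor for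
`NonCuspidalPoint`): `D_y := s(G_K̈)`, `evalAt :=` pull-back along `s` read through the presentation
`eK`, coordinate ANY `u ∈ K̈^×` off the cusps `±q̈^ℤ`. [cite: MochizukiEtTh2009, Prop 1.4 (iii) p.22] -/
def nonCuspidalPointOfSection
    (heK : ∀ c : E.KddHat, ContH1.comap D.toTheta D.DeltaTheta s hs hsY
      (D.inflTheta D.GtpYdd (E.kumYdd c)) = eK c)
    (u : (↥D.Kdd)ˣ)
    (hu : ∀ a : ℤ, ((u : D.Kdd) : PadicAlgCl p) ≠ D.qdd ^ a ∧ ((u : D.Kdd) : PadicAlgCl p) ≠ -(D.qdd ^ a)) :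
    NonCuspidalPoint E where
  Dpt := D.GKdd.map s
  Dpt_le := hsY
  aug_injOn := aug_injOn_map_section s hsec
  map_aug_Dpt := map_aug_map_section s hsec
  coord := u
  coord_ne_cusp := hu
  evalAt := E.evalAtOfSection s hs eK
  evalAt_kum := E.evalAtOfSection_kum s hs hsY eK heK

include hsec in
/-- **An ANCHORED point from a Galois section**: as `nonCuspidalPointOfSection`, plus the anchor
`log(Ü)|_{D_y} = Ü(y)`, supplied as `hanch` (pulling `infl log(Ü)` back along `s` presents `κ(u)`); `evalAt`
is injective automatically. [cite: MochizukiEtTh2009, Prop 1.4 (iii) p.22] -/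
def anchoredPointOfSection
    (heK : ∀ c : E.KddHat, ContH1.comap D.toTheta D.DeltaTheta s hs hsY
      (D.inflTheta D.GtpYdd (E.kumYdd c)) = eK c)
    (u : (↥D.Kdd)ˣ)
    (hu : ∀ a : ℤ, ((u : D.Kdd) : PadicAlgCl p) ≠ D.qdd ^ a ∧ ((u : D.Kdd) : PadicAlgCl p) ≠ -(D.qdd ^ a))
    (hanch : ContH1.comap D.toTheta D.DeltaTheta s hs hsY (D.inflTheta D.GtpYdd E.logUdd) =
      eK (E.toKddHat u)) :
    AnchoredPoint E where
  toNonCuspidalPoint := E.nonCuspidalPointOfSection s hs hsec hsY eK heK u hu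
  evalAt_injective := E.evalAtOfSection_injective s hs hsec eK
  evalAt_logUdd := by
    change E.evalAtOfSection s hs eK (ContH1.res D.toTheta D.DeltaTheta hsY
      (D.inflTheta D.GtpYdd E.logUdd)) = E.toKddHat u
    rw [evalAtOfSection_apply, comap_section_res, hanch, MulEquiv.symm_apply_apply]

/-- The coordinate of the constructed point is the given `u`. [cite: MochizukiEtTh2009, Prop 1.4 (iii) p.22] -/
@[simp] theorem coord_nonCuspidalPointOfSection
    (heK : ∀ c : E.KddHat, ContH1.comap D.toTheta D.DeltaTheta s hs hsY
      (D.inflTheta D.GtpYdd (E.kumYdd c)) = eK c)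
    (u : (↥D.Kdd)ˣ)
    (hu : ∀ a : ℤ, ((u : D.Kdd) : PadicAlgCl p) ≠ D.qdd ^ a ∧ ((u : D.Kdd) : PadicAlgCl p) ≠ -(D.qdd ^ a)) :
    (E.nonCuspidalPointOfSection s hs hsec hsY eK heK u hu).coord = u := rfl

/-- The decomposition group of the constructed point is `s(G_K̈)`. [cite: MochizukiEtTh2009, Prop 1.4 (iii) p.22] -/
@[simp] theorem Dpt_nonCuspidalPointOfSection
    (heK : ∀ c : E.KddHat, ContH1.comap D.toTheta D.DeltaTheta s hs hsY
      (D.inflTheta D.GtpYdd (E.kumYdd c)) = eK c)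
    (u : (↥D.Kdd)ˣ)
    (hu : ∀ a : ℤ, ((u : D.Kdd) : PadicAlgCl p) ≠ D.qdd ^ a ∧ ((u : D.Kdd) : PadicAlgCl p) ≠ -(D.qdd ^ a)) :
    (E.nonCuspidalPointOfSection s hs hsec hsY eK heK u hu).Dpt = D.GKdd.map s := rfl

include hsec in
/-- **Census consequence**: one Galois section into `Π^tp_Ÿ` with a compatible presentation of the
Kummer datum, plus one unit off the cusps, un-vacates `NonCuspidalPoint`. [cite: MochizukiEtTh2009, Prop 1.4 (iii) p.22] -/
theorem nonempty_nonCuspidalPoint_of_section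
    (heK : ∀ c : E.KddHat, ContH1.comap D.toTheta D.DeltaTheta s hs hsY
      (D.inflTheta D.GtpYdd (E.kumYdd c)) = eK c)
    (hu : ∃ u : (↥D.Kdd)ˣ, ∀ a : ℤ, ((u : D.Kdd) : PadicAlgCl p) ≠ D.qdd ^ a ∧
      ((u : D.Kdd) : PadicAlgCl p) ≠ -(D.qdd ^ a)) :
    Nonempty (NonCuspidalPoint E) := by
  obtain ⟨u, hu⟩ := hu
  exact ⟨E.nonCuspidalPointOfSection s hs hsec hsY eK heK u hu⟩

end KummerData

end ThetaSetting

/-! ### Def. 1.9: standard data from two anchored sections -/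

namespace MuTwoSetting

variable {p : ℕ} [Fact p.Prime] {M : MuTwoSetting p}

/-- **Def. 1.9 data from two points** ("suppose that `√−1 ∈ K` … the 4-torsion point `τ` … `τ⁻¹`
determined by `−√−1`", p. 29): `StandardData` from `√−1 ∈ K` and two non-cuspidal points of `Ÿ` with
coordinates `√−1`, `(√−1)⁻¹` (e.g. two section-points of `nonCuspidalPointOfSection`).
[cite: MochizukiEtTh2009, Def 1.9 p.29] -/
def standardDataOfPoints {E : M.toThetaSetting.KummerData} (i : PadicAlgCl p) (hiK : i ∈ M.K)
    (hi : i ^ 2 = -1) (τ τ' : ThetaSetting.NonCuspidalPoint E)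
    (hτ : ((τ.coord : M.Kdd) : PadicAlgCl p) = i) (hτ' : ((τ'.coord : M.Kdd) : PadicAlgCl p) = i⁻¹) :
    M.StandardData E where
  sqrtNegOne := i
  sqrtNegOne_mem := hiK
  sqrtNegOne_sq := hi
  tau := τ
  tauInv := τ'
  tau_coord := hτ
  tauInv_coord := hτ'

/-- **Anchored Def. 1.9 data from two anchored points** with coordinates `√−1`, `(√−1)⁻¹`
(abc-iut-L2-t1's `AnchoredStandardData`). [cite: MochizukiEtTh2009, Def 1.9 p.29] -/
def anchoredStandardDataOfPoints {E : M.toThetaSetting.KummerData} (i : PadicAlgCl p) (hiK : i ∈ M.K)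
    (hi : i ^ 2 = -1) (τ τ' : ThetaSetting.AnchoredPoint E)
    (hτ : ((τ.coord : M.Kdd) : PadicAlgCl p) = i) (hτ' : ((τ'.coord : M.Kdd) : PadicAlgCl p) = i⁻¹) :
    M.AnchoredStandardData E where
  sqrtNegOne := i
  sqrtNegOne_mem := hiK
  sqrtNegOne_sq := hi
  tau := τ
  tauInv := τ'
  tau_coord := hτ
  tauInv_coord := hτ'

/-- **Census consequence for Def. 1.9**: `√−1 ∈ K` and anchored section-points with coordinates `√−1`,
`(√−1)⁻¹` un-vacate `AnchoredStandardData` (hence `StandardData`). [cite: MochizukiEtTh2009, Def 1.9 p.29] -/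
theorem nonempty_anchoredStandardData_of_points {E : M.toThetaSetting.KummerData}
    (h : ∃ (i : PadicAlgCl p) (_ : i ∈ M.K) (_ : i ^ 2 = -1) (τ τ' : ThetaSetting.AnchoredPoint E),
      ((τ.coord : M.Kdd) : PadicAlgCl p) = i ∧ ((τ'.coord : M.Kdd) : PadicAlgCl p) = i⁻¹) :
    Nonempty (M.AnchoredStandardData E) ∧ Nonempty (M.StandardData E) := by
  obtain ⟨i, hiK, hi, τ, τ', hτ, hτ'⟩ := h
  exact ⟨⟨anchoredStandardDataOfPoints i hiK hi τ τ' hτ hτ'⟩,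
    ⟨(anchoredStandardDataOfPoints i hiK hi τ τ' hτ hτ').toStandardData⟩⟩

end MuTwoSetting

end Literature.AnabelianGeometry.EtaleTheta

end
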